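/-
Copyright (c) 2026 the pub-hodgecm-mathlib formalisation cell (harness21).  Prover seat hodgecm-mathlib-F0P2-p06 (g10): road «S3-tree» (LEAD F0P3a-plan (g11), architect
A-p16 (g29) ruling A-63 (1) «T2-E′ = THE LOCAL FIXED-SPHERE DICTIONARY»), brick T2-E′, FILE 2 = the dictionary at a TYPE-TWO vertex (superlattice neighbours); 2026-09-01.
-/
import Literature.NumberTheory.Automorphic.UnitaryLatticeTreeTypeTwoNormalForm   -- ★ T1d-C1 (B-p14 (g35)): `N₁ = latt diag(1,1,ϖ)`, `mapGL_latt_eq`, T1a `mapGL`, `latt`, `latticeGraphIso`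
import HarnessLib

/-!
# The lattice graph of a hermitian space — T2-E′ FILE 2: THE FIXED STAR OF A TYPE-TWO VERTEX — a lattice automorphism `γ` of `M` fixes the superlattice neighbour `M + 𝒪w`
# (`ϖw ∈ M`, `w ∉ M`) iff `γ̄` fixes the residual point `[w̄]` of `M^♯ ∕ M` (Bruhat–Tits 1972 §10; Tits 1979 §3.5; Serre, *Trees* II.1.1)

Topic `NumberTheory/Automorphic`; namespace `Literature.NumberTheory.Automorphic.UnitaryLatticeTree`.  THEOREMS ONLY (no definition, no instance, no notation, no named fact,
no `sorry`); kernel lane.  Cell `pub/hodgecm-mathlib` (D-0151), crux H413 = `stmt-HodgeConjecture-24833`; road «S3-tree» (census «S3» v3 0ca147ac), brick **T2-E′ «THE LOCAL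
FIXED-SPHERE DICTIONARY»** (architect A-p16 (g29) ruling A-63 (1)), FILE 2 = the TYPE-TWO half, sequel of FILE 1 `UnitaryLatticeTreeFixedStar` (the hyperspecial half).
In the `U(3)` tree a type-two vertex `M` (`ϖM^♯ < M < M^♯`, `M^♯∕M ≅ 𝓀²`) has as neighbours the self-dual SUPERLATTICES `M < L < M^♯`, i.e. `L = M + 𝒪w` for `w ∈ M^♯ ∖ M`
(then `ϖw ∈ M`) spanning an ISOTROPIC point `[w̄]` of the residual plane `(M^♯∕M, ϖ·B₀)` — `q + 1` of them (T1's valency lemma, B-p14 (g35)).  THIS FILE types the FIXED-POINT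
LAYER of that picture, which is FORM-FREE: for any `𝒪`-lattice `M ⊆ K^N`, any `g ∈ GL_N(K)` with `g·M = M`, and any `w` with `ϖw ∈ M`, `w ∉ M` (a «level-one» vector over `M`:
its class `w̄` spans a line `𝒪w̄ ≅ 𝓀` of `K^N ∕ M`), **`g·(M + 𝒪w) = M + 𝒪w ↔ ∃ c, |c| = 1 ∧ g w − c·w ∈ M`** («`g` fixes the neighbour through `[w̄]` iff `ḡ w̄ ∈ 𝓀^× w̄`»),
together with `M + 𝒪w = M + 𝒪w′ ↔ w′ ≡ c·w (mod M)` (same neighbour ↔ same residual point).  §2 instantiates at the standard type-two vertex `N₁ = latt diag(1,1,ϖ)` of ★ T1d-C1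
and gives the vertex form for ★ `latticeGraphIso` (every type-two vertex is `u·N₁` by T1d′ transitivity, and `Fix` transports along `u`); the sequel FILE 3
`UnitaryLatticeTreeFixedCostarCoords` adds coordinates on `N₁^♯ ∕ N₁` and the residual action (the S-a3 input).
HONEST LABEL: HC_CM is proved only modulo the 2 remaining named inputs (hLiu418 24832, h413 24833) until rung 0 closes; nothing printed is asserted here (elementary lattice
algebra over a valuation ring); S3 (`stub_N6nsS3id`) stays a print row until the road's END lands.

* §1 (any `N`, any lattice `M`, FORM-FREE): `smul_mem_of_v_lt_one_of_smul_mem` (plumbing), `sup_span_eq_sup_span_of_sub_mem`, **`sup_span_eq_sup_span_iff`** (same neighbour ↔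
  `w′ ≡ c·w (mod M)`, `|c| = 1`; hypotheses `ϖw ∈ M`, `w′ ∉ M` only), `mapGL_sup_span` (`g·(M + 𝒪w) = g·M + 𝒪(gw)`), **`mapGL_sup_span_eq_iff`** (THE FIXED-COSTAR TEST: `g·M = M` ⇒
  (`g·(M + 𝒪w) = M + 𝒪w ↔ ∃ c, |c| = 1 ∧ g w − c·w ∈ M`)), `mapGL_sup_span_eq_of_sub_mem` (`g w − w ∈ M` ⇒ fixed: the level-one congruence case).
* §2 (`N = 3`, `N₁`): `smul_ϖ_mem_N₁_of_mem_dual` (`w ∈ latt diag(ϖ⁻¹,1,1) ⇒ ϖw ∈ N₁`), **`latticeGraphIso_sup_span_eq_iff`** (vertex form at `v.1 = u·(N₁ + 𝒪w)` for `γ` with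
  `(u⁻¹γu)·N₁ = N₁`).
* The sequel FILE 3 `UnitaryLatticeTreeFixedCostarCoords` puts coordinates `w(a,b) = (a∕ϖ, 0, b)` on `N₁^♯ ∕ N₁`, computes the residual action of `Stab(N₁)` and identifies
  the self-dual neighbours of `N₁` with the isotropic points of the residual hyperbolic plane (the S-a3 input).

## References
* [BruhatTits1972] F. Bruhat, J. Tits, *Groupes réductifs sur un corps local I*, Publ. Math. IHÉS 41 (1972), §10 (lattice models; the star of a vertex = the residual building).
* [Tits1979] J. Tits, *Reductive groups over local fields*, PSPM 33.1 (1979), §3.5 (reduction mod `𝔭`: the stabiliser acts on the star through its reductive quotient).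
* [Serre1980Trees] J.-P. Serre, *Trees* (1980), Ch. II §1.1 (neighbours of a lattice = lines of its reduction).
-/

set_option autoImplicit false

noncomputable section

open scoped Valued WithZero Matrix MatrixGroups

namespace Literature.NumberTheory.Automorphic.UnitaryLatticeTree

open Literature.NumberTheory.Automorphic Literature.NumberTheory.Automorphic.HermitianLattice

variable {K : Type*} [Field K] [Valued K ℤᵐ⁰] {N : ℕ}

/-! ## §1 The fixed-costar test: superlattice neighbours `M + 𝒪w` of a lattice `M` (form-free, any `N`) -/

/-- Plumbing: if `ϖw ∈ M` and `|a| < 1` (so `a ∈ ϖ𝒪` by discreteness, `|ϖ| = exp(−1)`) then `a·w ∈ M`. [cite: Serre1980Trees, II.1.1] -/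
theorem smul_mem_of_v_lt_one_of_smul_mem {ϖ : K} (hϖ : Valued.v ϖ = WithZero.exp (-1 : ℤ)) {M : Submodule 𝒪[K] (Fin N → K)} {w : Fin N → K}
    (hw : ϖ • w ∈ M) {a : K} (ha : Valued.v a < 1) : a • w ∈ M := by
  have hϖ0 : ϖ ≠ 0 := fun h0 => by rw [h0, map_zero] at hϖ; exact WithZero.coe_ne_zero hϖ.symm
  have hb : Valued.v (a / ϖ) ≤ 1 := by
    rw [map_div₀, hϖ, div_le_one₀ WithZero.exp_pos]
    exact (v_lt_one_iff a).1 ha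
  have hmem := M.smul_mem (⟨a / ϖ, (Valuation.mem_integer_iff _ _).2 hb⟩ : 𝒪[K]) hw
  have heq : ((⟨a / ϖ, (Valuation.mem_integer_iff _ _).2 hb⟩ : 𝒪[K]) • (ϖ • w) : Fin N → K) = a • w := by
    change (a / ϖ) • (ϖ • w) = a • w
    rw [smul_smul, div_mul_cancel₀ a hϖ0]
  rwa [heq] at hmem

/-- (⇐) `w′ ≡ c·w (mod M)` with `c ∈ 𝒪^×` ⇒ `M + 𝒪w′ = M + 𝒪w`. [cite: Serre1980Trees, II.1.1] -/
theorem sup_span_eq_sup_span_of_sub_mem {M : Submodule 𝒪[K] (Fin N → K)} {w w' : Fin N → K} {c : K} (hc : Valued.v c = 1) (h : w' - c • w ∈ M) :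
    M ⊔ Submodule.span 𝒪[K] {w'} = M ⊔ Submodule.span 𝒪[K] {w} := by
  have hc0 : c ≠ 0 := fun h0 => by rw [h0, map_zero] at hc; exact zero_ne_one hc
  have hcO : c ∈ 𝒪[K] := (Valuation.mem_integer_iff _ _).2 hc.le
  have hciO : c⁻¹ ∈ 𝒪[K] := (Valuation.mem_integer_iff _ _).2 (by rw [map_inv₀, hc, inv_one])
  apply le_antisymm
  · refine sup_le le_sup_left ((Submodule.span_singleton_le_iff_mem _ _).2 ?_)
    have hw'eq : w' = (w' - c • w) + ((⟨c, hcO⟩ : 𝒪[K]) • w) := by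
      change w' = (w' - c • w) + c • w; rw [sub_add_cancel]
    rw [hw'eq]
    exact Submodule.add_mem _ (Submodule.mem_sup_left h) (Submodule.mem_sup_right (Submodule.smul_mem _ _ (Submodule.mem_span_singleton_self w)))
  · refine sup_le le_sup_left ((Submodule.span_singleton_le_iff_mem _ _).2 ?_)
    have hweq : w = ((⟨c⁻¹, hciO⟩ : 𝒪[K]) • w') - ((⟨c⁻¹, hciO⟩ : 𝒪[K]) • (w' - c • w)) := by
      change w = c⁻¹ • w' - c⁻¹ • (w' - c • w)
      rw [smul_sub, sub_sub_cancel, smul_smul, inv_mul_cancel₀ hc0, one_smul]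
    rw [hweq]
    exact Submodule.sub_mem _ (Submodule.mem_sup_right (Submodule.smul_mem _ _ (Submodule.mem_span_singleton_self w'))) (Submodule.mem_sup_left (Submodule.smul_mem _ _ h))

/-- **SAME NEIGHBOUR ↔ SAME RESIDUAL POINT**: if `ϖw ∈ M` and `w′ ∉ M` then `M + 𝒪w′ = M + 𝒪w ↔ ∃ c, |c| = 1 ∧ w′ − c·w ∈ M` (for level-one `w, w′` over `M` this is
«the lines `𝓀w̄′ = 𝓀w̄` in `K^N ∕ M`»; only the two displayed hypotheses are used). [cite: Serre1980Trees, II.1.1] [cite: BruhatTits1972, §10] -/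
theorem sup_span_eq_sup_span_iff {ϖ : K} (hϖ : Valued.v ϖ = WithZero.exp (-1 : ℤ)) {M : Submodule 𝒪[K] (Fin N → K)} {w w' : Fin N → K}
    (hw : ϖ • w ∈ M) (hw'M : w' ∉ M) :
    M ⊔ Submodule.span 𝒪[K] {w'} = M ⊔ Submodule.span 𝒪[K] {w} ↔ ∃ c : K, Valued.v c = 1 ∧ w' - c • w ∈ M := by
  refine ⟨fun heq => ?_, fun ⟨c, hc, h⟩ => sup_span_eq_sup_span_of_sub_mem hc h⟩
  -- `w′ ∈ M + 𝒪w`: `w′ = m + r·w` with `r ∈ 𝒪`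
  have hw'mem : w' ∈ M ⊔ Submodule.span 𝒪[K] {w} := by
    rw [← heq]; exact Submodule.mem_sup_right (Submodule.mem_span_singleton_self w')
  obtain ⟨m, hm, z, hz, hmz⟩ := Submodule.mem_sup.1 hw'mem
  obtain ⟨r, rfl⟩ := Submodule.mem_span_singleton.1 hz
  have hsub : w' - (r : K) • w ∈ M := by
    have : w' - (r : K) • w = m := by rw [← hmz]; change m + (r : K) • w - (r : K) • w = m; rw [add_sub_cancel_right]
    rw [this]; exact hm
  -- `|r| = 1`: otherwise `r·w ∈ M` (level one) and `w′ ∈ M`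
  have hr1 : Valued.v (r : K) ≤ 1 := (Valuation.mem_integer_iff _ _).1 r.2
  rcases hr1.lt_or_eq with hlt | hr
  · exact absurd (by
      have := Submodule.add_mem _ hsub (smul_mem_of_v_lt_one_of_smul_mem hϖ hw hlt)
      rwa [sub_add_cancel] at this) hw'M
  · exact ⟨r, hr, hsub⟩

/-- `g·(M + 𝒪w) = g·M + 𝒪(g w)`. [cite: Serre1980Trees, II.1.1] -/
theorem mapGL_sup_span (g : GL (Fin N) K) (M : Submodule 𝒪[K] (Fin N → K)) (w : Fin N → K) :
    mapGL g (M ⊔ Submodule.span 𝒪[K] {w}) = mapGL g M ⊔ Submodule.span 𝒪[K] {(g : Matrix (Fin N) (Fin N) K).mulVec w} := by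
  rw [mapGL, mapGL, Submodule.map_sup, Submodule.map_span, Set.image_singleton, LinearMap.restrictScalars_apply, Matrix.toLin'_apply]

/-- **THE FIXED-COSTAR TEST** (T2-E′, type 2; form-free): if `g·M = M` and `w` is a level-one vector over `M` (`ϖw ∈ M`, `w ∉ M`), then `g` FIXES the superlattice neighbour
`M + 𝒪w` iff `ḡ` fixes the residual point `[w̄]` of `K^N ∕ M`: `g·(M + 𝒪w) = M + 𝒪w ↔ ∃ c, |c| = 1 ∧ g w − c·w ∈ M`.  At a type-two vertex `M` of the `U(3)` tree (neighbours =
the `q+1` isotropic points of `(M^♯∕M, ϖB₀)`) this is `Fix(γ) ∩ S₁(M)` ↔ the `γ̄_M`-fixed isotropic points. [cite: BruhatTits1972, §10] [cite: Tits1979, §3.5] [cite: Serre1980Trees, II.1.1] -/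
theorem mapGL_sup_span_eq_iff {ϖ : K} (hϖ : Valued.v ϖ = WithZero.exp (-1 : ℤ)) {g : GL (Fin N) K} {M : Submodule 𝒪[K] (Fin N → K)} (hgM : mapGL g M = M)
    {w : Fin N → K} (hw : ϖ • w ∈ M) (hwM : w ∉ M) :
    mapGL g (M ⊔ Submodule.span 𝒪[K] {w}) = M ⊔ Submodule.span 𝒪[K] {w} ↔ ∃ c : K, Valued.v c = 1 ∧ (g : Matrix (Fin N) (Fin N) K).mulVec w - c • w ∈ M := by
  rw [mapGL_sup_span, hgM]
  refine sup_span_eq_sup_span_iff hϖ hw fun hgw => ?_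
  -- `g w ∈ M = g·M` would force `w ∈ M`
  rw [← hgM, mem_mapGL_iff, Matrix.mulVec_mulVec, ← Units.val_mul, inv_mul_cancel, Units.val_one, Matrix.one_mulVec] at hgw
  exact hwM hgw

/-- The level-one congruence case: if `g·M = M` and `g w − w ∈ M` then `g` fixes `M + 𝒪w` (e.g. `g ≡ 1` on `M^♯ ∕ M`: `g` fixes the whole star of the type-two vertex `M`).
[cite: Tits1979, §3.5] [cite: BruhatTits1972, §10] -/
theorem mapGL_sup_span_eq_of_sub_mem {g : GL (Fin N) K} {M : Submodule 𝒪[K] (Fin N → K)} (hgM : mapGL g M = M) {w : Fin N → K}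
    (h : (g : Matrix (Fin N) (Fin N) K).mulVec w - w ∈ M) :
    mapGL g (M ⊔ Submodule.span 𝒪[K] {w}) = M ⊔ Submodule.span 𝒪[K] {w} := by
  rw [mapGL_sup_span, hgM]
  exact sup_span_eq_sup_span_of_sub_mem (c := 1) (map_one _) (by rwa [one_smul])

/-! ## §2 At the standard type-two vertex `N₁ = latt diag(1, 1, ϖ)` of the `U(3)` tree -/

section TypeTwo

variable {σ : K →+* K} {ϖ : K}

/-- `w ∈ N₁^♯ = latt diag(ϖ⁻¹, 1, 1)` ⇒ `ϖw ∈ N₁ = latt diag(1, 1, ϖ)`: every vector of the dual lattice is level-one over `N₁` (or lies in `N₁`). [cite: BruhatTits1972, §10] -/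
theorem smul_ϖ_mem_N₁_of_mem_dual (hϖ : Valued.v ϖ = WithZero.exp (-1 : ℤ)) {w : Fin 3 → K} (hw : w ∈ latt (Matrix.diagonal ![ϖ⁻¹, (1 : K), 1])) :
    ϖ • w ∈ latt (Matrix.diagonal ![(1 : K), 1, ϖ]) := by
  have hϖ0 : ϖ ≠ 0 := fun h0 => by rw [h0, map_zero] at hϖ; exact WithZero.coe_ne_zero hϖ.symm
  have hϖ1 : Valued.v ϖ ≤ 1 := by rw [hϖ, ← WithZero.exp_zero]; exact WithZero.exp_le_exp.2 (by norm_num)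
  have hd : ∀ i, (![ϖ⁻¹, (1 : K), 1] : Fin 3 → K) i ≠ 0 := by intro i; fin_cases i <;> simp [hϖ0]
  have hd' : ∀ i, (![(1 : K), 1, ϖ] : Fin 3 → K) i ≠ 0 := by intro i; fin_cases i <;> simp [hϖ0]
  rw [mem_latt_diagonal_iff hd] at hw
  refine (mem_latt_diagonal_iff hd' _).2 fun i => ?_
  rw [Pi.smul_apply, smul_eq_mul, map_mul]
  fin_cases i
  · have h0 := hw 0
    simp only [Fin.zero_eta, Matrix.cons_val_zero, map_inv₀] at h0 ⊢
    rw [map_one]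
    calc Valued.v ϖ * Valued.v (w 0) ≤ Valued.v ϖ * (Valued.v ϖ)⁻¹ := mul_le_mul_right h0 _
      _ = 1 := mul_inv_cancel₀ ((Valuation.ne_zero_iff _).2 hϖ0)
  · have h1 := hw 1
    simp only [Fin.mk_one, Matrix.cons_val_one, Matrix.cons_val_zero, map_one] at h1 ⊢
    calc Valued.v ϖ * Valued.v (w 1) ≤ 1 * 1 := mul_le_mul' hϖ1 h1
      _ = 1 := one_mul 1
  · have h2 := hw 2
    simp only [Fin.reduceFinMk, Matrix.cons_val_two, Matrix.tail_cons, Matrix.head_cons, Nat.succ_eq_add_one, map_one] at h2 ⊢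
    calc Valued.v ϖ * Valued.v (w 2) ≤ Valued.v ϖ * 1 := mul_le_mul_right h2 _
      _ = Valued.v ϖ := mul_one _

/-- **Vertex form of the fixed-costar test at `u·N₁`**: for `u ∈ U(σ, J₀)`, a level-one `w` over `N₁`, the vertex `v` with `v.1 = u·(N₁ + 𝒪w)`, and `γ ∈ U(σ, J₀)` whose
conjugate `u⁻¹γu` fixes `N₁`: `latticeGraphIso σ ϖ J₀ γ v = v ↔ ∃ c, |c| = 1 ∧ (u⁻¹γu) w − c·w ∈ N₁` — `γ` fixes the self-dual neighbour of the type-two vertex `u·N₁` through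
`[w̄]` iff `γ̄` fixes `[w̄]`. [cite: BruhatTits1972, §10] [cite: Tits1979, §3.5] -/
theorem latticeGraphIso_sup_span_eq_iff (hϖ : Valued.v ϖ = WithZero.exp (-1 : ℤ))
    (u γ : unitaryGroupOfForm σ ((StdForm.antidiagonal 3).over K))
    (hγ : mapGL ((u⁻¹ * γ * u : unitaryGroupOfForm σ ((StdForm.antidiagonal 3).over K)) : GL (Fin 3) K) (latt (Matrix.diagonal ![(1 : K), 1, ϖ])) =
      latt (Matrix.diagonal ![(1 : K), 1, ϖ]))
    {w : Fin 3 → K} (hw : ϖ • w ∈ latt (Matrix.diagonal ![(1 : K), 1, ϖ])) (hwM : w ∉ latt (Matrix.diagonal ![(1 : K), 1, ϖ]))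
    (v : {M : Submodule 𝒪[K] (Fin 3 → K) // IsVertex σ ϖ ((StdForm.antidiagonal 3).over K) M})
    (hv : v.1 = mapGL (u : GL (Fin 3) K) (latt (Matrix.diagonal ![(1 : K), 1, ϖ]) ⊔ Submodule.span 𝒪[K] {w})) :
    latticeGraphIso σ ϖ ((StdForm.antidiagonal 3).over K) γ v = v ↔
      ∃ c : K, Valued.v c = 1 ∧
        (((u⁻¹ * γ * u : unitaryGroupOfForm σ ((StdForm.antidiagonal 3).over K)) : GL (Fin 3) K) : Matrix (Fin 3) (Fin 3) K).mulVec w - c • w ∈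
          latt (Matrix.diagonal ![(1 : K), 1, ϖ]) := by
  rw [Subtype.ext_iff, latticeGraphIso_apply_coe, hv]
  change mapGL (γ : GL (Fin 3) K) (mapGL (u : GL (Fin 3) K) _) = mapGL (u : GL (Fin 3) K) _ ↔ _
  have key : ∀ X : Submodule 𝒪[K] (Fin 3 → K),
      mapGL (γ : GL (Fin 3) K) (mapGL (u : GL (Fin 3) K) X) = mapGL (u : GL (Fin 3) K) X ↔
        mapGL ((u⁻¹ * γ * u : unitaryGroupOfForm σ ((StdForm.antidiagonal 3).over K)) : GL (Fin 3) K) X = X := by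
    intro X
    rw [Subgroup.coe_mul, Subgroup.coe_mul, Subgroup.coe_inv, mapGL_mul, mapGL_mul]
    constructor
    · intro h; rw [h, ← mapGL_mul, inv_mul_cancel, mapGL_one]
    · intro h
      have h' := congrArg (mapGL (u : GL (Fin 3) K)) h
      rwa [← mapGL_mul, mul_inv_cancel, mapGL_one] at h'
  rw [key]
  exact mapGL_sup_span_eq_iff hϖ hγ hw hwM

end TypeTwo


end Literature.NumberTheory.Automorphic.UnitaryLatticeTree

end
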